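import Summits.CriticalPhenomena.PercolationContinuityZ3.Theorems.PercNearOneGluingNoHeavyQuantBudgetFlow
import Summits.CriticalPhenomena.PercolationContinuityZ3.Theorems.PercNearOneGluingNoHeavyQuantFlowBlobUnits
import Summits.CriticalPhenomena.PercolationContinuityZ3.Theorems.PercNearOneGluingNoHeavyQuantGatedSliceMixLawExchange
import HarnessLib

/-!
# QUANT lane R8, T-DEC: THE BUDGET CRITERION WITH NEAR ABSORBERS — positive low atoms may first be shipped, in part, to the self-sufficient atoms
# BELOW the target (`T/2 < h ≤ T`, `h > T − l`, at the all-layer gate `max(y, (T−2l)/(h−l))`); the remaining demand is then tested against the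
# torque budget of the atoms above the target (arm-1 gen 49, architect — lead g47's 'budget → greedy with near absorbers ≤ T')

builds on p205010 (kernel theorem, internal audit signed; external expert review pending)

Support file (`--supports stmt-CriticalPhenomena-4575`), QUANT lane seat prim-quant-arm-1 (gen 49, architect), rung R8 of
`run/shared/lean/prim/quant/LADDER.md`; memo `run/shared/lean/prim/quant/prim-quant-arm-1-g49/ARCH-G49.md` §9.  Theorems only (no definitions), standard
axioms, no sorries.  Combines `flowAtT_of_budget` (`…QuantBudgetFlow`, ✓ p423876) with the single-pair flows of `…QuantGatedSliceMixLawExchange`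
(`flowAtT_pair`) through the cone property (`FlowAtT.add`, `flowAtT_finset_sum`, `…QuantFlowBlobUnits`).

WHY.  The budget criterion ignores the NEAR absorbers — atoms `h` with `T − l < h ≤ T` (hence `2h > T`, self-sufficient), which carry no torque budget but
can take a positive low atom `l` in a pair `{l, h; γ}` with `γ = max(y, (T − 2l)/(h − l))`, valid at EVERY layer (giant rule by `γ ≥ y`, credit rule by
`2l + (h − l)γ ≥ T`; mass cost `κ = γ/(1 − γ)` per unit).  On the identical glued census these near absorbers are exactly what the four budget misses need
(gapped shapes near `q = .98`, `a ≥ .99`: the barely-low atom `3A` ships to `5, 6 ≤ T`), and census-1 g24's one-low partner `3A + B` is such an absorber.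
THIS FILE: a PARTIAL NEAR FLOW `φ l h ≥ 0` (data: how much of the low `l` goes to the near absorber `h`) with
  rows `Σ_h φ l h ≤ A l`, capacities `Σ_l κ(l,h)·φ l h ≤ A h`,
peeled off first (each pair is flow-feasible at every layer: `flowAtT_pairNear`), and the REMAINDER — lows reduced to `A l − Σ_h φ l h`, near absorbers
reduced, atoms above `T` untouched, first moment still `≥ T·mass` — tested by the budget criterion with a torque-safe ceiling `H`:
  `Σ_{l ≥ 1 low} (A l − Σ_h φ l h)·(T − l) ≤ Σ_{T < h ≤ H} A h·(h − T)`   ⟹   `FlowAtT y T j′ M A` at every layer `j′ < M`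
(**`flowAtT_of_budget_near`**), and `DECAt` at every layer for a probability law at its mean (**`decAt_all_of_budget_near`**).  With `φ = 0` this is
`flowAtT_of_budget`; with one pair and zero remaining demand it is census-1's one-low peeling.

* `kappaNear y T l h` is written inline as `max y ρ / (1 − max y ρ)`, `ρ = (T − 2l)/(h − l)`; `usage_le_kappaNear` (it bounds the lane's `usage` at
  every layer), `flowAtT_pairNear` (one near pair is flow-feasible at every layer);
* **`flowAtT_of_budget_near`**, **`decAt_all_of_budget_near`**.

HONEST STATUS: a law-level DEC criterion; `ResidDEC`, `SiblingStep`, `GateStepN`, `FarTreeRow` OPEN; RATE class log\* / honest sentence of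
`run/shared/lean/prim/quant/README.md` unchanged.  [this work]; pair flows / cone property: this lane (typer g23–g26); one-low peeling: prim-quant-census-1 g24.
Nothing here is cited as a published result.  The gluing rows served [cite: KozmaNitzan2024, Conjecture 3 (p. 15)]; product measure
[cite: Grimmett1999, §1.3 p. 10].
-/

noncomputable section

open scoped BigOperators

namespace Summit.CriticalPhenomena.PercolationContinuityZ3.Theorems
namespace Quant
namespace LawDec

open Finset

/-! ### One near pair at the all-layer gate -/

/-- **the all-layer gate bounds the usage**: for a low `l` (`2l < T`), `l < h`, `T < l + h`, floor `0 < y < 1`, with `γ = max(y, (T − 2l)/(h − l))`: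
`usage y T j′ l h ≤ γ/(1 − γ)` at every layer (giant: `y ≤ γ`; mid: `pairGate = max(ρ, y² + (1−y)ρ) ≤ γ`). [this work] -/
theorem usage_le_kappaNear (y T : ℝ) (j' l h : ℕ) (hy0 : 0 < y) (hy1 : y < 1) (hlow : 2 * (l : ℝ) < T) (hlh : l < h)
    (hcomp : T < (l : ℝ) + h) :
    usage y T j' l h ≤ max y ((T - 2 * (l : ℝ)) / ((h : ℝ) - l)) / (1 - max y ((T - 2 * (l : ℝ)) / ((h : ℝ) - l))) := by
  set ρ : ℝ := (T - 2 * (l : ℝ)) / ((h : ℝ) - l) with hρ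
  set γ : ℝ := max y ρ with hγ
  have hhl : (0 : ℝ) < (h : ℝ) - l := by
    have : (l : ℝ) < h := by exact_mod_cast hlh
    linarith
  have hρ1 : ρ < 1 := by rw [hρ, div_lt_one hhl]; linarith
  have hρ0 : 0 ≤ ρ := by rw [hρ]; exact div_nonneg (by linarith) hhl.le
  have hγ1 : γ < 1 := max_lt hy1 hρ1
  have hyγ : y ≤ γ := le_max_left _ _
  have mono : ∀ {s t : ℝ}, s ≤ t → t < 1 → s / (1 - s) ≤ t / (1 - t) := by
    intro s t hst ht
    have hs : 0 < 1 - s := by linarith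
    have ht' : 0 < 1 - t := by linarith
    rw [div_le_div_iff₀ hs ht']
    nlinarith
  by_cases hg : j' + 1 ≤ h
  · rw [usage_giant_eq y T j' l h hg]
    exact mono hyγ hγ1
  · simp only [usage, gateOf, if_neg hg]
    refine mono ?_ hγ1
    unfold pairGate
    refine max_le (le_max_right _ _) ?_
    -- `y² + (1−y)ρ ≤ max y ρ`
    rcases le_total ρ y with h1 | h1
    · calc y ^ 2 + (1 - y) * ((T - 2 * (l : ℝ)) / ((h : ℝ) - l)) = y ^ 2 + (1 - y) * ρ := by rw [hρ]
        _ ≤ y ^ 2 + (1 - y) * y := by nlinarith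
        _ = y := by ring
        _ ≤ γ := hyγ
    · calc y ^ 2 + (1 - y) * ((T - 2 * (l : ℝ)) / ((h : ℝ) - l)) = y ^ 2 + (1 - y) * ρ := by rw [hρ]
        _ ≤ y * ρ + (1 - y) * ρ := by nlinarith
        _ = ρ := by ring
        _ ≤ γ := le_max_right _ _

/-- **one near pair is flow-feasible at every layer**: `φ ≥ 0` at a low `1 ≤ l` (`2l < T`) together with `κ·φ` at an absorber `h ≤ M` with `l < h`,
`T < l + h` (`κ = γ/(1−γ)`, `γ = max(y, (T−2l)/(h−l))`) — at layers `j′ ≥ l` the pair ships (`flowAtT_pair`), at layers `j′ < l` nothing is low. [this work] -/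
theorem flowAtT_pairNear (y T : ℝ) (j' M l h : ℕ) (φ : ℝ) (hy0 : 0 < y) (hy1 : y < 1) (hφ : 0 ≤ φ) (hlow : 2 * (l : ℝ) < T)
    (hlh : l < h) (hhM : h ≤ M) (hcomp : T < (l : ℝ) + h) :
    FlowAtT y T j' M (fun t => φ * (if t = l then (1 : ℝ) else 0) +
      (max y ((T - 2 * (l : ℝ)) / ((h : ℝ) - l)) / (1 - max y ((T - 2 * (l : ℝ)) / ((h : ℝ) - l))) * φ) * (if t = h then (1 : ℝ) else 0)) := by
  have h2h : T ≤ 2 * (h : ℝ) := by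
    have : (l : ℝ) < h := by exact_mod_cast hlh
    linarith
  have hκ0 : 0 ≤ max y ((T - 2 * (l : ℝ)) / ((h : ℝ) - l)) / (1 - max y ((T - 2 * (l : ℝ)) / ((h : ℝ) - l))) := by
    have hhl : (0 : ℝ) < (h : ℝ) - l := by
      have : (l : ℝ) < h := by exact_mod_cast hlh
      linarith
    have hρ1 : (T - 2 * (l : ℝ)) / ((h : ℝ) - l) < 1 := by rw [div_lt_one hhl]; linarith
    have hγ1 : max y ((T - 2 * (l : ℝ)) / ((h : ℝ) - l)) < 1 := max_lt hy1 hρ1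
    exact div_nonneg (le_trans hy0.le (le_max_left _ _)) (by linarith)
  by_cases hlj : l ≤ j'
  · exact flowAtT_pair y T j' M l h φ _ hlj hlow hhM (Or.inr h2h) (Or.inr hcomp) hφ
      (mul_le_mul_of_nonneg_right (usage_le_kappaNear y T j' l h hy0 hy1 hlow hlh hcomp) hφ)
  · -- no low atom is charged at this layer
    refine ⟨fun _ _ => 0, fun _ _ => le_rfl, fun _ _ hp => absurd hp (lt_irrefl 0), fun t htj htlow => ?_, fun t _ _ => ?_⟩
    · rw [Finset.sum_const_zero]
      have h1 : t ≠ l := by rintro rfl; exact hlj htj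
      have h2 : t ≠ h := by rintro rfl; linarith
      simp [h1, h2]
    · simp only [mul_zero, Finset.sum_const_zero]
      refine add_nonneg (mul_nonneg hφ ?_) (mul_nonneg (mul_nonneg hκ0 hφ) ?_) <;> split_ifs <;> norm_num

/-! ### The budget criterion with near absorbers -/

/-- **THE FIRST-MOMENT BUDGET CRITERION WITH NEAR ABSORBERS (flow form).**  `A ≥ 0` on `{0..M}` (vanishing above `M`), target `T > 0`, floor `0 < y < 1`,
`y·M ≤ T`, first moment `≥ T·mass`; a partial near flow `φ ≥ 0` (`φ l h > 0` only for a positive low `l` and a near absorber `h`: `1 ≤ l`, `2l < T`, `l < h ≤ M`,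
`T < l + h`, `h ≤ T`) with rows `Σ_h φ l h ≤ A l` and capacities `Σ_l κ(l,h)·φ l h ≤ A h`; a ceiling `H` torque-safe for every positive low atom with
demand left; and the REDUCED demand covered by the budget: `Σ_{1 ≤ l, 2l < T} (A l − Σ_h φ l h)(T − l) ≤ Σ_{T < h ≤ H} A h (h − T)`.  Then
`FlowAtT y T j′ M A` for every `j′ < M`. [this work] -/
theorem flowAtT_of_budget_near (y T : ℝ) (j' M H : ℕ) (A : ℕ → ℝ) (φ : ℕ → ℕ → ℝ) (hy0 : 0 < y) (hy1 : y < 1) (hT : 0 < T)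
    (hj : j' < M) (hA0 : ∀ h, 0 ≤ A h) (hAM : ∀ h, M < h → A h = 0) (hta : y * (M : ℝ) ≤ T)
    (hmom : T * ∑ h ∈ Finset.range (M + 1), A h ≤ ∑ h ∈ Finset.range (M + 1), (h : ℝ) * A h)
    (hφ0 : ∀ l h, 0 ≤ φ l h)
    (hφsupp : ∀ l h, 0 < φ l h → 1 ≤ l ∧ 2 * (l : ℝ) < T ∧ l < h ∧ h ≤ M ∧ T < (l : ℝ) + h ∧ (h : ℝ) ≤ T)
    (hrow : ∀ l, ∑ h ∈ Finset.range (M + 1), φ l h ≤ A l)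
    (hcap : ∀ h : ℕ, ∑ l ∈ Finset.range (M + 1),
      (max y ((T - 2 * (l : ℝ)) / ((h : ℝ) - l)) / (1 - max y ((T - 2 * (l : ℝ)) / ((h : ℝ) - l)))) * φ l h ≤ A h)
    (hsafe : ∀ l : ℕ, 1 ≤ l → 2 * (l : ℝ) < T → ∑ h ∈ Finset.range (M + 1), φ l h < A l → y * ((H : ℝ) - l) ≤ T - l)
    (hbud : ∑ l ∈ Finset.range (M + 1), (if (1 ≤ l ∧ 2 * (l : ℝ) < T) then (A l - ∑ h ∈ Finset.range (M + 1), φ l h) * (T - l) else 0)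
      ≤ ∑ h ∈ Finset.range (M + 1), (if (T < (h : ℝ) ∧ h ≤ H) then A h * ((h : ℝ) - T) else 0)) :
    FlowAtT y T j' M A := by
  classical
  set R := Finset.range (M + 1) with hR
  -- the rate of a near pair
  set κ : ℕ → ℕ → ℝ := fun l h =>
    max y ((T - 2 * (l : ℝ)) / ((h : ℝ) - l)) / (1 - max y ((T - 2 * (l : ℝ)) / ((h : ℝ) - l))) with hκ
  -- the peeled pairs and the remainder
  set P : ℕ → ℕ → ℕ → ℝ := fun l h t =>
    φ l h * (if t = l then (1 : ℝ) else 0) + (κ l h * φ l h) * (if t = h then (1 : ℝ) else 0) with hP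
  set A₂ : ℕ → ℝ := fun t => ∑ l ∈ R, ∑ h ∈ R, P l h t with hA₂
  set row : ℕ → ℝ := fun t => ∑ h ∈ R, φ t h with hrowd
  set col : ℕ → ℝ := fun t => ∑ l ∈ R, κ l t * φ l t with hcold
  -- support facts
  have hφM : ∀ l h, M < h → φ l h = 0 := fun l h hh => by
    by_contra hne
    have := (hφsupp l h (lt_of_le_of_ne (hφ0 l h) (Ne.symm hne))).2.2.2.1; omega
  have hφL : ∀ l h, M < l → φ l h = 0 := fun l h hl => by
    by_contra hne
    obtain ⟨_, _, hlh, hhM, _⟩ := hφsupp l h (lt_of_le_of_ne (hφ0 l h) (Ne.symm hne)); omega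
  have hκ0 : ∀ l h, 0 < φ l h → 0 ≤ κ l h := fun l h hp => by
    obtain ⟨_, hllow, hlh, _, hcomp, _⟩ := hφsupp l h hp
    have hhl : (0 : ℝ) < (h : ℝ) - l := by
      have : (l : ℝ) < h := by exact_mod_cast hlh
      linarith
    have hρ1 : (T - 2 * (l : ℝ)) / ((h : ℝ) - l) < 1 := by rw [div_lt_one hhl]; linarith
    have hγ1 : max y ((T - 2 * (l : ℝ)) / ((h : ℝ) - l)) < 1 := max_lt hy1 hρ1
    simp only [hκ]
    exact div_nonneg (le_trans hy0.le (le_max_left _ _)) (by linarith)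
  have hκφ0 : ∀ l h, 0 ≤ κ l h * φ l h := fun l h => by
    rcases (hφ0 l h).eq_or_lt with hz | hp
    · rw [← hz, mul_zero]
    · exact mul_nonneg (hκ0 l h hp) hp.le
  -- A₂ = row + col pointwise
  have hA₂val : ∀ t, A₂ t = row t + col t := by
    intro t
    by_cases ht : t ∈ R
    · have e1 : ∀ l ∈ R, ∑ h ∈ R, P l h t = (if t = l then row l else 0) + κ l t * φ l t := by
        intro l _
        simp only [hP, Finset.sum_add_distrib]
        congr 1
        · rw [← Finset.sum_mul]
          split_ifs <;> simp [hrowd]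
        · have e : ∀ h ∈ R, κ l h * φ l h * (if t = h then (1 : ℝ) else 0) = if t = h then κ l h * φ l h else 0 := by
            intro h _; split_ifs <;> simp
          rw [Finset.sum_congr rfl e, Finset.sum_ite_eq, if_pos ht]
      simp only [hA₂]
      rw [Finset.sum_congr rfl e1, Finset.sum_add_distrib, Finset.sum_ite_eq, if_pos ht]
    · have htM : M < t := by rw [hR, Finset.mem_range] at ht; omega
      have e1 : ∀ l ∈ R, ∑ h ∈ R, P l h t = 0 := by
        intro l _
        refine Finset.sum_eq_zero fun h _ => ?_
        simp only [hP]
        by_cases h1 : t = l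
        · subst h1; rw [hφL t h htM]; simp
        · by_cases h2 : t = h
          · subst h2; rw [hφM l t htM]; simp
          · simp [h1, h2]
      have r0 : row t = 0 := Finset.sum_eq_zero fun h _ => hφL t h htM
      have c0 : col t = 0 := Finset.sum_eq_zero fun l _ => by rw [hφM l t htM, mul_zero]
      simp only [hA₂]
      rw [Finset.sum_congr rfl e1, Finset.sum_const_zero, r0, c0, add_zero]
  -- rows vanish off the positive lows, columns vanish off the near absorbers
  have hrow0 : ∀ t : ℕ, ¬ (1 ≤ t ∧ 2 * (t : ℝ) < T) → row t = 0 := fun t hn => by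
    simp only [hrowd]
    refine Finset.sum_eq_zero fun h _ => ?_
    by_contra hne
    obtain ⟨h1, h2, _⟩ := hφsupp t h (lt_of_le_of_ne (hφ0 t h) (Ne.symm hne))
    exact hn ⟨h1, h2⟩
  have hcol0 : ∀ t : ℕ, ¬ (T < 2 * (t : ℝ) ∧ (t : ℝ) ≤ T) → col t = 0 := fun t hn => by
    simp only [hcold]
    refine Finset.sum_eq_zero fun l _ => ?_
    rcases (hφ0 l t).eq_or_lt with hz | hp
    · rw [← hz, mul_zero]
    · obtain ⟨_, _, hlt, _, hcomp, htT⟩ := hφsupp l t hp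
      have : (l : ℝ) < t := by exact_mod_cast hlt
      exact absurd ⟨by linarith, htT⟩ hn
  have hrow_nn : ∀ t, 0 ≤ row t := fun t => Finset.sum_nonneg fun h _ => hφ0 t h
  have hcol_nn : ∀ t, 0 ≤ col t := fun t => Finset.sum_nonneg fun l _ => hκφ0 l t
  -- the remainder
  set A₁ : ℕ → ℝ := fun t => A t - A₂ t with hA₁
  have hA₁val : ∀ t, A₁ t = A t - row t - col t := fun t => by simp only [hA₁, hA₂val]; ring
  have hA₁0 : ∀ t, 0 ≤ A₁ t := by
    intro t
    rw [hA₁val]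
    by_cases h1 : 1 ≤ t ∧ 2 * (t : ℝ) < T
    · rw [hcol0 t (fun hc => by linarith [hc.1, h1.2]), sub_zero]
      linarith [hrow t]
    · rw [hrow0 t h1]
      by_cases h2 : T < 2 * (t : ℝ) ∧ (t : ℝ) ≤ T
      · have hc := hcap t
        have : col t = ∑ l ∈ R, κ l t * φ l t := rfl
        rw [this]; linarith
      · rw [hcol0 t h2]; linarith [hA0 t]
  have hA₁M : ∀ t, M < t → A₁ t = 0 := fun t ht => by
    rw [hA₁val, hAM t ht]
    have r0 : row t = 0 := Finset.sum_eq_zero fun h _ => hφL t h ht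
    have c0 : col t = 0 := Finset.sum_eq_zero fun l _ => by rw [hφM l t ht, mul_zero]
    rw [r0, c0]; ring
  have hA₁low : ∀ l : ℕ, 1 ≤ l → 2 * (l : ℝ) < T → A₁ l = A l - row l := fun l h1 h2 => by
    rw [hA₁val, hcol0 l (fun hc => by linarith [hc.1])]; ring
  have hA₁high : ∀ h : ℕ, T < (h : ℝ) → A₁ h = A h := fun h hh => by
    rw [hA₁val, hrow0 h (fun hc => by linarith [hc.2, (Nat.cast_nonneg h : (0:ℝ) ≤ h)]), hcol0 h (fun hc => by linarith [hc.2])]; ring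
  -- first moment of the remainder: every peeled pair has mean ≤ T per unit
  have hmom₁ : T * ∑ t ∈ R, A₁ t ≤ ∑ t ∈ R, (t : ℝ) * A₁ t := by
    have key : ∑ t ∈ R, ((t : ℝ) - T) * A₂ t ≤ 0 := by
      -- Σ_t (t − T)·A₂ t = Σ_l Σ_h [φ (l − T) + κ φ (h − T)] ≤ 0
      have e0 : ∑ t ∈ R, ((t : ℝ) - T) * A₂ t = ∑ l ∈ R, ∑ h ∈ R, ∑ t ∈ R, ((t : ℝ) - T) * P l h t := by
        simp only [hA₂, Finset.mul_sum]
        rw [Finset.sum_comm]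
        exact Finset.sum_congr rfl fun l _ => Finset.sum_comm
      rw [e0]
      refine Finset.sum_nonpos fun l hl => Finset.sum_nonpos fun h hh => ?_
      have e : ∑ t ∈ R, ((t : ℝ) - T) * P l h t = ((l : ℝ) - T) * φ l h + ((h : ℝ) - T) * (κ l h * φ l h) := by
        simp only [hP]
        have e1 : ∀ t : ℕ, ((t : ℝ) - T) * (φ l h * (if t = l then (1 : ℝ) else 0) + κ l h * φ l h * (if t = h then (1 : ℝ) else 0))
            = (if t = l then ((l : ℝ) - T) * φ l h else 0) + (if t = h then ((h : ℝ) - T) * (κ l h * φ l h) else 0) := by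
          intro t
          by_cases h1 : t = l
          · subst h1
            by_cases h2 : t = h
            · subst h2; simp only [if_true]; ring
            · rw [if_pos rfl, if_neg h2, if_pos rfl, if_neg h2]; ring
          · by_cases h2 : t = h
            · subst h2; rw [if_neg h1, if_pos rfl, if_neg h1, if_pos rfl]; ring
            · rw [if_neg h1, if_neg h2, if_neg h1, if_neg h2]; ring
        rw [Finset.sum_congr rfl fun t _ => e1 t, Finset.sum_add_distrib, Finset.sum_ite_eq' R l, Finset.sum_ite_eq' R h,
          if_pos hl, if_pos hh]
      rw [e]
      rcases (hφ0 l h).eq_or_lt with hz | hp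
      · rw [← hz]; simp
      · obtain ⟨_, hllow, _, _, _, hhT⟩ := hφsupp l h hp
        have hlT : (l : ℝ) ≤ T := by linarith [(Nat.cast_nonneg l : (0 : ℝ) ≤ l)]
        nlinarith [hκ0 l h hp, mul_nonneg (hκ0 l h hp) hp.le]
    have e : ∑ t ∈ R, (t : ℝ) * A₁ t - T * ∑ t ∈ R, A₁ t
        = (∑ t ∈ R, (t : ℝ) * A t - T * ∑ t ∈ R, A t) - ∑ t ∈ R, ((t : ℝ) - T) * A₂ t := by
      simp only [hA₁, Finset.mul_sum, ← Finset.sum_sub_distrib]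
      exact Finset.sum_congr rfl fun t _ => by ring
    have : 0 ≤ ∑ t ∈ R, (t : ℝ) * A t - T * ∑ t ∈ R, A t := by linarith
    linarith
  -- the remainder passes the budget criterion
  have hF₁ : FlowAtT y T j' M A₁ := by
    refine flowAtT_of_budget y T j' M H A₁ hy0 hy1 hT hj hA₁0 hA₁M hta hmom₁ (fun l hl1 hllow hpos => ?_) ?_
    · rw [hA₁low l hl1 hllow] at hpos
      exact hsafe l hl1 hllow (by linarith)
    · have e1 : ∀ l ∈ R, (if (1 ≤ l ∧ 2 * (l : ℝ) < T) then A₁ l * (T - l) else 0)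
          = (if (1 ≤ l ∧ 2 * (l : ℝ) < T) then (A l - ∑ h ∈ Finset.range (M + 1), φ l h) * (T - l) else 0) := by
        intro l _
        split_ifs with hc
        · rw [hA₁low l hc.1 hc.2]
        · rfl
      have e2 : ∀ h ∈ R, (if (T < (h : ℝ) ∧ h ≤ H) then A₁ h * ((h : ℝ) - T) else 0)
          = (if (T < (h : ℝ) ∧ h ≤ H) then A h * ((h : ℝ) - T) else 0) := by
        intro h _
        split_ifs with hc
        · rw [hA₁high h hc.1]
        · rfl
      rw [Finset.sum_congr rfl e1, Finset.sum_congr rfl e2]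
      exact hbud
  -- the peeled pairs are flow-feasible
  have hF₂ : FlowAtT y T j' M A₂ := by
    refine flowAtT_finset_sum y T j' M R (fun l t => ∑ h ∈ R, P l h t) (fun l _ => ?_)
    refine flowAtT_finset_sum y T j' M R (fun h t => P l h t) (fun h _ => ?_)
    rcases (hφ0 l h).eq_or_lt with hz | hp
    · have e : (fun t => P l h t) = fun _ => 0 := by funext t; simp only [hP, ← hz]; ring
      rw [e]; exact flowAtT_zero y T j' M
    · obtain ⟨_, hllow, hlh, hhM, hcomp, _⟩ := hφsupp l h hp
      exact flowAtT_pairNear y T j' M l h (φ l h) hy0 hy1 hp.le hllow hlh hhM hcomp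
  have hsum := FlowAtT.add hF₁ hF₂
  have e : (fun k => A₁ k + A₂ k) = A := by funext k; simp only [hA₁]; ring
  rw [e] at hsum
  exact hsum

/-- **THE BUDGET CRITERION WITH NEAR ABSORBERS AT THE MEAN**: a probability law with the data of `flowAtT_of_budget_near` is DEC at floor `y` at every
layer `j′ < M`. [this work] -/
theorem decAt_all_of_budget_near (y : ℝ) (M H : ℕ) (μ : ℕ → ℝ) (φ : ℕ → ℕ → ℝ) (T : ℝ) (hy0 : 0 < y) (hy1 : y < 1)
    (hμ0 : ∀ h, 0 ≤ μ h) (hμM : ∀ h, M < h → μ h = 0) (hμ1 : ∑ h ∈ Finset.range (M + 1), μ h = 1)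
    (hT : ∑ h ∈ Finset.range (M + 1), (h : ℝ) * μ h = T) (hT0 : 0 < T) (hta : y * (M : ℝ) ≤ T)
    (hφ0 : ∀ l h, 0 ≤ φ l h)
    (hφsupp : ∀ l h, 0 < φ l h → 1 ≤ l ∧ 2 * (l : ℝ) < T ∧ l < h ∧ h ≤ M ∧ T < (l : ℝ) + h ∧ (h : ℝ) ≤ T)
    (hrow : ∀ l, ∑ h ∈ Finset.range (M + 1), φ l h ≤ μ l)
    (hcap : ∀ h : ℕ, ∑ l ∈ Finset.range (M + 1),
      (max y ((T - 2 * (l : ℝ)) / ((h : ℝ) - l)) / (1 - max y ((T - 2 * (l : ℝ)) / ((h : ℝ) - l)))) * φ l h ≤ μ h)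
    (hsafe : ∀ l : ℕ, 1 ≤ l → 2 * (l : ℝ) < T → ∑ h ∈ Finset.range (M + 1), φ l h < μ l → y * ((H : ℝ) - l) ≤ T - l)
    (hbud : ∑ l ∈ Finset.range (M + 1), (if (1 ≤ l ∧ 2 * (l : ℝ) < T) then (μ l - ∑ h ∈ Finset.range (M + 1), φ l h) * (T - l) else 0)
      ≤ ∑ h ∈ Finset.range (M + 1), (if (T < (h : ℝ) ∧ h ≤ H) then μ h * ((h : ℝ) - T) else 0)) :
    ∀ j', j' < M → DECAt y j' M μ := by
  intro j' hj'
  rw [decAt_iff_decAtT, hT]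
  exact decAtT_of_flowAtT y T j' M μ hy0 hy1 hμM hμ1
    (flowAtT_of_budget_near y T j' M H μ φ hy0 hy1 hT0 hj' hμ0 hμM hta (by rw [hμ1, hT, mul_one]) hφ0 hφsupp hrow hcap hsafe hbud)


end LawDec
end Quant
end Summit.CriticalPhenomena.PercolationContinuityZ3.Theorems
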